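import Summits.NavierStokesRegularity.NavierStokesRegularity.Theorems.EulerZoomLiouvillePowerGaugeEulerLiouvillePowerClockRigidityProfile
import Summits.NavierStokesRegularity.NavierStokesRegularity.Theorems.EulerZoomLiouvillePowerGaugeEulerLiouvilleBreatherProfileGradient

/-!
# Crux `EulerZoomLiouville.PowerGaugeEulerLiouville` (stmt-NavierStokesRegularity-19832), line `logtime-breathers` (T4):
# the weak gradient of a classical power clock in profile variables and its `E`-growth

Width seat `ns-ezl-w4` (power-clock rigidity, file II; twin of `…BreatherProfileGradient`).  For a classical power clock
`u(τ, y) = (T₀−τ)^{γ−1} W((T₀−τ)^{−γ} y)` (`T₀ ≥ 0`):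

* `ae_slice_gradient_eq` — a weak spatial gradient `H` of `u` on the slab is `(T₀−τ)^{−1} ∇W((T₀−τ)^{−γ}·)` a.e., for a.e. `τ < 0`;
* `profile_gradient_growth_of_gaugeE` — the `E`-gauge gives `∫_{B_L}|∇W|²_F ≤ C L^{1−ρ}` for `L ≥ 2` (`0 ≤ γ ≤ 2/3`).

WHAT THIS IS NOT: not NS regularity, not the crux — data bricks; `--supports` stmt-19832. [folklore]
-/

noncomputable section

set_option linter.dupNamespace false

open MeasureTheory Set Filter Topology Metric Function TopologicalSpace
open scoped ENNReal NNReal RealInnerProductSpace ContDiff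

namespace Summit.NavierStokesRegularity.NavierStokesRegularity.Theorems.PowerGaugeEulerLiouville

open Literature.Analysis Literature.Analysis.FunctionSpaces Literature.Analysis.FluidPDE

namespace PowerClockRigidity

variable {u : ℝ → EuclideanSpace ℝ (Fin 3) → EuclideanSpace ℝ (Fin 3)} {p : ℝ → EuclideanSpace ℝ (Fin 3) → ℝ}
  {H : ℝ → EuclideanSpace ℝ (Fin 3) → EuclideanSpace ℝ (Fin 3) →L[ℝ] EuclideanSpace ℝ (Fin 3)}
  {T₀ g : ℝ} {W : EuclideanSpace ℝ (Fin 3) → EuclideanSpace ℝ (Fin 3)}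

/-! ### The weak gradient in profile variables -/

/-- **Slices of the weak gradient of a classical power clock.**  If `H` is a weak spatial gradient of `u` on the slab
`(−∞,0) × ℝ³` and `u(τ, y) = (T₀−τ)^{γ−1} W((T₀−τ)^{−γ} y)` classically (`T₀ ≥ 0`), then for a.e. `τ < 0`:
`H(τ) = (T₀−τ)^{−1} ∇W((T₀−τ)^{−γ}·)` a.e. on `ℝ³` (uniqueness of weak derivatives against the classical slice derivative). [folklore] -/
theorem ae_slice_gradient_eq
    (hH : HasWeakSpatialGradientOn (slab (EuclideanSpace ℝ (Fin 3)) (Iio 0) isOpen_Iio) u H)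
    (hcl : IsClassicalEulerSolutionOn (Iio 0) 0 u p) (hT₀ : 0 ≤ T₀)
    (hW : ∀ τ : ℝ, τ < 0 → ∀ y, u τ y = (T₀ - τ) ^ (g - 1) • W ((T₀ - τ) ^ (-g) • y)) :
    ∀ᵐ τ ∂((volume : Measure ℝ).restrict (Iio (0 : ℝ))),
      H τ =ᵐ[volume] fun x => (T₀ - τ) ^ (-1 : ℝ) • fderiv ℝ W ((T₀ - τ) ^ (-g) • x) := by
  have hWd : Differentiable ℝ W := (PowerClock.contDiff_profile hcl hT₀ hW).differentiable (by norm_num)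
  -- a.e. slice below `0` is a weak derivative on `ℝ³` (adapted from `Past.exists_profileGradient_ae_of_past`)
  have hslice0 : ∀ᵐ τ ∂((volume : Measure ℝ).restrict (Iio (0 : ℝ))),
      HasWeakFDerivOn (⊤ : Opens (EuclideanSpace ℝ (Fin 3))) volume (u τ) (H τ) := by
    have hU : (Iio (0 : ℝ)) = ⋃ n : ℕ, Ioo (-((n : ℝ) + 1)) 0 := by
      refine subset_antisymm (fun t ht => mem_iUnion.2 ?_) (iUnion_subset fun n t ht => ht.2)
      obtain ⟨n, hn⟩ := exists_nat_gt (-t)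
      exact ⟨n, ⟨by linarith, ht⟩⟩
    rw [hU, ae_restrict_iUnion_iff]
    intro n
    have hn : HasWeakSpatialGradientOn
        (slab (EuclideanSpace ℝ (Fin 3)) (Ioo (-((n : ℝ) + 1)) 0) isOpen_Ioo) u H :=
      hH.mono (slab_mono Ioo_subset_Iio_self)
    exact hn.ae_hasWeakFDerivOn_slice_slab
  filter_upwards [hslice0, ae_restrict_mem measurableSet_Iio] with τ hWk hτ
  have hτ' : τ < 0 := hτ
  have hC1 : ContDiff ℝ 1 (u τ) := (hcl.contDiff_velocity hτ').of_le (by exact_mod_cast le_top)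
  have hcl' : HasWeakFDerivOn (⊤ : Opens (EuclideanSpace ℝ (Fin 3))) volume (u τ) (fderiv ℝ (u τ)) :=
    hasWeakGradient_fderiv_of_contDiff hC1
  have huniq := HasWeakFDerivOn.unique_holds hWk hcl'
  rw [Opens.coe_top, Measure.restrict_univ] at huniq
  filter_upwards [huniq] with x hx
  rw [hx, (hasFDerivAt_slice hWd hT₀ hW hτ' x).fderiv]

/-! ### `E`-growth of the profile gradient at large scales -/

/-- **Ball integrals of `|s⁻¹ ∇W(d·)|²_F` — the clock dilation lower bound**: for `s, d > 0` and `L ≤ d a`,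
`s^{−2} d^{−3} ∫_{B_L} |G|²_F ≤ ∫_{B_a} |s^{−1} G(d x)|²_F dx`. [folklore] -/
theorem lintegral_ball_frobeniusNormSq_clockDilate_ge {s d : ℝ} (hs : 0 < s) (hd : 0 < d)
    (G : EuclideanSpace ℝ (Fin 3) → EuclideanSpace ℝ (Fin 3) →L[ℝ] EuclideanSpace ℝ (Fin 3)) {a L : ℝ}
    (hLa : L ≤ d * a) :
    ENNReal.ofReal (s ^ (-2 : ℝ)) * ENNReal.ofReal ((d ^ 3)⁻¹) *
        ∫⁻ y in ball (0 : EuclideanSpace ℝ (Fin 3)) L, ENNReal.ofReal (frobeniusNormSq (G y)) ≤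
      ∫⁻ x in ball (0 : EuclideanSpace ℝ (Fin 3)) a,
        ENNReal.ofReal (frobeniusNormSq (s ^ (-1 : ℝ) • G (d • x))) := by
  have h1 : ∀ x, ENNReal.ofReal (frobeniusNormSq (s ^ (-1 : ℝ) • G (d • x))) =
      ENNReal.ofReal (s ^ (-2 : ℝ)) * ENNReal.ofReal (frobeniusNormSq (G (d • x))) := by
    intro x
    rw [frobeniusNormSq_smul, ← ENNReal.ofReal_mul (by positivity), ← Real.rpow_natCast,
      ← Real.rpow_mul hs.le]
    norm_num
  rw [lintegral_congr fun x => h1 x, lintegral_const_mul' _ _ ENNReal.ofReal_ne_top, mul_assoc]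
  exact mul_le_mul' le_rfl (BreatherRigidity.lintegral_ball_frobeniusNormSq_dilate_ge hd G hLa)

/-- **THE `E`-GAUGE OF A CLASSICAL POWER CLOCK IN PROFILE VARIABLES (large scales).**  Let `H` be a.e.-strongly measurable on the
slab with `H(τ) = (T₀−τ)^{−1} ∇W((T₀−τ)^{−γ}·)` a.e. for a.e. `τ < 0` (output of `ae_slice_gradient_eq`), `T₀ ≥ 0`, `0 ≤ γ ≤ 2/3`, and
`a^{ρ} E(a; 0; H) ≤ c₀` for all `a > 0`.  Then, with `S = T₀ + 2`, for every `L ≥ 2`: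
`∫_{B_L} |∇W|²_F ≤ S^{2−3γ} (S^{γ})^{1−ρ} c₀ · L^{1−ρ}` (window `(−2,−1) × B_a ⊆ Q_a(0,0)`, `a = S^{γ} L`, Tonelli, on each window slice
`S^{3γ−2}∫_{B_L}|∇W|²_F ≤ ∫_{B_a}|H(τ)|²_F`).  Template: `Past.profile_gradient_growth_of_gaugeE_past` (rate `1/(2+ρ)`). [folklore] -/
theorem profile_gradient_growth_of_gaugeE {ρ : ℝ} {c₀ : ℝ≥0} (hT₀ : 0 ≤ T₀) (hg0 : 0 ≤ g) (hg23 : 3 * g - 2 ≤ 0)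
    (hHm : AEStronglyMeasurable (uncurry H)
      (volume.restrict (Iio (0 : ℝ) ×ˢ (univ : Set (EuclideanSpace ℝ (Fin 3))))))
    (hHV : ∀ᵐ τ ∂((volume : Measure ℝ).restrict (Iio (0 : ℝ))),
      H τ =ᵐ[volume] fun x => (T₀ - τ) ^ (-1 : ℝ) • fderiv ℝ W ((T₀ - τ) ^ (-g) • x))
    (hE : ∀ a : ℝ, 0 < a →
      ENNReal.ofReal (a ^ ρ) * cknE a (0 : ℝ × EuclideanSpace ℝ (Fin 3)) H ≤ (c₀ : ℝ≥0∞)) :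
    ∀ L : ℝ, 2 ≤ L →
      ∫⁻ y in ball (0 : EuclideanSpace ℝ (Fin 3)) L, ENNReal.ofReal (frobeniusNormSq (fderiv ℝ W y)) ≤
        ENNReal.ofReal ((T₀ + 2) ^ (2 - 3 * g) * ((T₀ + 2) ^ g) ^ (1 - ρ)) * (c₀ : ℝ≥0∞) *
          ENNReal.ofReal (L ^ (1 - ρ)) := by
  -- adapted from `Past.profile_gradient_growth_of_gaugeE_past` / `BreatherRigidity.profile_gradient_growth_of_gaugeE`
  intro L hL
  set G : EuclideanSpace ℝ (Fin 3) → EuclideanSpace ℝ (Fin 3) →L[ℝ] EuclideanSpace ℝ (Fin 3) := fderiv ℝ W with hG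
  have hfm : Measurable fun L : EuclideanSpace ℝ (Fin 3) →L[ℝ] EuclideanSpace ℝ (Fin 3) =>
      ENNReal.ofReal (frobeniusNormSq L) :=
    (SereginZajaczkowski2007.continuous_frobeniusNormSq).measurable.ennreal_ofReal
  have hL0 : 0 < L := by linarith
  set S : ℝ := T₀ + 2 with hS
  have hS0 : 0 < S := by rw [hS]; linarith
  have hS1 : 1 ≤ S := by rw [hS]; linarith
  set σ : ℝ := S ^ g with hσ
  have hσ1 : 1 ≤ σ := Real.one_le_rpow hS1 hg0
  have hσ0 : 0 < σ := by linarith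
  -- ### the radius `a = σ L`
  set a : ℝ := σ * L with ha
  have haL : L ≤ a := by rw [ha]; nlinarith
  have ha0 : 0 < a := by linarith
  have ha2 : (2 : ℝ) ≤ a ^ 2 := by nlinarith
  -- ### (1) the gauge: `X = ∫∫_{Q_a} |H|²_F ≤ a^{1−ρ} c₀`
  set X : ℝ≥0∞ := ∫⁻ q in parabolicCylinder a (0 : ℝ × EuclideanSpace ℝ (Fin 3)),
    ENNReal.ofReal (frobeniusNormSq (H q.1 q.2)) with hX
  have hXle : X ≤ ENNReal.ofReal (a ^ (1 - ρ)) * (c₀ : ℝ≥0∞) := by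
    have h1 := hE a ha0
    unfold cknE at h1
    have hB0 : ENNReal.ofReal (a ^ ρ) ≠ 0 := by
      rw [ENNReal.ofReal_ne_zero_iff]; exact Real.rpow_pos_of_pos ha0 _
    have hA0 : ENNReal.ofReal a ≠ 0 := by rw [ENNReal.ofReal_ne_zero_iff]; exact ha0
    have key : X = ENNReal.ofReal a * (ENNReal.ofReal (a ^ ρ))⁻¹ *
        (ENNReal.ofReal (a ^ ρ) * ((ENNReal.ofReal a)⁻¹ * X)) := by
      rw [← mul_assoc, mul_assoc (ENNReal.ofReal a), ENNReal.inv_mul_cancel hB0 ENNReal.ofReal_ne_top,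
        mul_one, ← mul_assoc, ENNReal.mul_inv_cancel hA0 ENNReal.ofReal_ne_top, one_mul]
    calc X = _ := key
      _ ≤ ENNReal.ofReal a * (ENNReal.ofReal (a ^ ρ))⁻¹ * (c₀ : ℝ≥0∞) := by gcongr
      _ = ENNReal.ofReal (a ^ (1 - ρ)) * (c₀ : ℝ≥0∞) := by
          rw [← ENNReal.ofReal_inv_of_pos (Real.rpow_pos_of_pos ha0 _), ← ENNReal.ofReal_mul ha0.le]
          congr 2
          rw [Real.rpow_sub ha0, Real.rpow_one, div_eq_mul_inv]
  -- ### (2) the window `(−2, −1) × B_a` inside `Q_a(0,0)`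
  have hWsub : Ioo (-2 : ℝ) (-1) ×ˢ ball (0 : EuclideanSpace ℝ (Fin 3)) a ⊆
      parabolicCylinder a (0 : ℝ × EuclideanSpace ℝ (Fin 3)) := by
    intro q hq
    rw [mem_prod, mem_Ioo, mem_ball] at hq
    rw [mem_parabolicCylinder, Prod.fst_zero, Prod.snd_zero, zero_sub]
    exact ⟨⟨by linarith [hq.1.1], by linarith [hq.1.2]⟩, hq.2⟩
  have hY : ∫⁻ q in Ioo (-2 : ℝ) (-1) ×ˢ ball (0 : EuclideanSpace ℝ (Fin 3)) a,
      ENNReal.ofReal (frobeniusNormSq (H q.1 q.2)) ≤ X :=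
    lintegral_mono_set hWsub
  -- ### (3) Tonelli on the window
  have hHmW : AEMeasurable (fun q : ℝ × EuclideanSpace ℝ (Fin 3) =>
      ENNReal.ofReal (frobeniusNormSq (H q.1 q.2)))
      (((volume : Measure ℝ).restrict (Ioo (-2 : ℝ) (-1))).prod
        ((volume : Measure (EuclideanSpace ℝ (Fin 3))).restrict (ball 0 a))) := by
    have hsub : Ioo (-2 : ℝ) (-1) ×ˢ ball (0 : EuclideanSpace ℝ (Fin 3)) a ⊆
        Iio (0 : ℝ) ×ˢ (univ : Set (EuclideanSpace ℝ (Fin 3))) :=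
      prod_mono (fun t ht => by have := ht.2; rw [mem_Iio]; linarith) (subset_univ _)
    have := hfm.comp_aemeasurable (hHm.mono_measure (Measure.restrict_mono hsub le_rfl)).aemeasurable
    rwa [Measure.volume_eq_prod, ← Measure.prod_restrict] at this
  have hYeq : ∫⁻ q in Ioo (-2 : ℝ) (-1) ×ˢ ball (0 : EuclideanSpace ℝ (Fin 3)) a,
        ENNReal.ofReal (frobeniusNormSq (H q.1 q.2)) =
      ∫⁻ τ in Ioo (-2 : ℝ) (-1), ∫⁻ x in ball (0 : EuclideanSpace ℝ (Fin 3)) a,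
        ENNReal.ofReal (frobeniusNormSq (H τ x)) := by
    rw [Measure.volume_eq_prod, ← Measure.prod_restrict, lintegral_prod _ hHmW]
  -- ### (4) the a.e. lower bound on the slices of the window
  set J : ℝ≥0∞ := ∫⁻ y in ball (0 : EuclideanSpace ℝ (Fin 3)) L, ENNReal.ofReal (frobeniusNormSq (G y)) with hJ
  have hWT : Ioo (-2 : ℝ) (-1) ⊆ Iio 0 := fun t ht => by have := ht.2; rw [mem_Iio]; linarith
  have hlow : ∀ᵐ τ ∂((volume : Measure ℝ).restrict (Ioo (-2 : ℝ) (-1))),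
      ENNReal.ofReal (S ^ (3 * g - 2)) * J ≤
        ∫⁻ x in ball (0 : EuclideanSpace ℝ (Fin 3)) a, ENNReal.ofReal (frobeniusNormSq (H τ x)) := by
    filter_upwards [ae_restrict_of_ae_restrict_of_subset hWT hHV, ae_restrict_mem measurableSet_Ioo]
      with τ hτ hτW
    have hs : 0 < T₀ - τ := by have := hτW.2; linarith
    have hsS : T₀ - τ ≤ S := by have := hτW.1; rw [hS]; linarith
    set d : ℝ := (T₀ - τ) ^ (-g) with hd
    have hd0 : 0 < d := Real.rpow_pos_of_pos hs _
    -- replace `H τ` by the clock-dilated classical gradient on the ball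
    have hcongr : ∫⁻ x in ball (0 : EuclideanSpace ℝ (Fin 3)) a, ENNReal.ofReal (frobeniusNormSq (H τ x)) =
        ∫⁻ x in ball (0 : EuclideanSpace ℝ (Fin 3)) a,
          ENNReal.ofReal (frobeniusNormSq ((T₀ - τ) ^ (-1 : ℝ) • G (d • x))) :=
      lintegral_congr_ae (ae_restrict_of_ae (hτ.mono fun x hx => by simp only [hx, hG, hd]))
    rw [hcongr]
    have hLa : L ≤ d * a := by
      have h1 : S ^ (-g) ≤ d := by
        rw [hd]; exact Real.rpow_le_rpow_of_nonpos hs hsS (by linarith)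
      have h2 : S ^ (-g) * a = L := by
        rw [ha, hσ, ← mul_assoc, ← Real.rpow_add hS0, neg_add_cancel, Real.rpow_zero, one_mul]
      rw [← h2]
      exact mul_le_mul_of_nonneg_right h1 ha0.le
    have hcoef : S ^ (3 * g - 2) ≤ (T₀ - τ) ^ (-2 : ℝ) * (d ^ 3)⁻¹ := by
      have e1 : (T₀ - τ) ^ (-2 : ℝ) * (d ^ 3)⁻¹ = (T₀ - τ) ^ (3 * g - 2) := by
        rw [hd, ← Real.rpow_natCast, ← Real.rpow_mul hs.le, ← Real.rpow_neg hs.le, ← Real.rpow_add hs]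
        congr 1; push_cast; ring
      rw [e1]
      exact Real.rpow_le_rpow_of_nonpos hs hsS hg23
    calc ENNReal.ofReal (S ^ (3 * g - 2)) * J
        ≤ ENNReal.ofReal ((T₀ - τ) ^ (-2 : ℝ) * (d ^ 3)⁻¹) * J := mul_le_mul' (ENNReal.ofReal_le_ofReal hcoef) le_rfl
      _ = ENNReal.ofReal ((T₀ - τ) ^ (-2 : ℝ)) * ENNReal.ofReal ((d ^ 3)⁻¹) * J := by
          rw [ENNReal.ofReal_mul (Real.rpow_nonneg hs.le _)]
      _ ≤ _ := lintegral_ball_frobeniusNormSq_clockDilate_ge hs hd0 G hLa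
  -- ### (5) integrate the lower bound over the window (length `1`)
  have hvolW : volume (Ioo (-2 : ℝ) (-1)) = 1 := by
    rw [Real.volume_Ioo, show (-1 : ℝ) - -2 = 1 by ring, ENNReal.ofReal_one]
  have hJle : ENNReal.ofReal (S ^ (3 * g - 2)) * J ≤ X :=
    calc ENNReal.ofReal (S ^ (3 * g - 2)) * J
        = ∫⁻ _ in Ioo (-2 : ℝ) (-1), ENNReal.ofReal (S ^ (3 * g - 2)) * J := by
          rw [setLIntegral_const, hvolW, mul_one]
      _ ≤ ∫⁻ τ in Ioo (-2 : ℝ) (-1), ∫⁻ x in ball (0 : EuclideanSpace ℝ (Fin 3)) a,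
            ENNReal.ofReal (frobeniusNormSq (H τ x)) := lintegral_mono_ae hlow
      _ = _ := hYeq.symm
      _ ≤ X := hY
  -- ### (6) assemble
  have haρ : a ^ (1 - ρ) = σ ^ (1 - ρ) * L ^ (1 - ρ) := by
    rw [ha, Real.mul_rpow hσ0.le hL0.le]
  have hunit : ENNReal.ofReal (S ^ (2 - 3 * g)) * ENNReal.ofReal (S ^ (3 * g - 2)) = 1 := by
    rw [← ENNReal.ofReal_mul (Real.rpow_nonneg hS0.le _), ← Real.rpow_add hS0,
      show (2 - 3 * g) + (3 * g - 2) = 0 by ring, Real.rpow_zero, ENNReal.ofReal_one]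
  calc J = ENNReal.ofReal (S ^ (2 - 3 * g)) * (ENNReal.ofReal (S ^ (3 * g - 2)) * J) := by
        rw [← mul_assoc, hunit, one_mul]
    _ ≤ ENNReal.ofReal (S ^ (2 - 3 * g)) * X := by gcongr
    _ ≤ ENNReal.ofReal (S ^ (2 - 3 * g)) * (ENNReal.ofReal (a ^ (1 - ρ)) * (c₀ : ℝ≥0∞)) := by gcongr
    _ = ENNReal.ofReal (S ^ (2 - 3 * g) * σ ^ (1 - ρ)) * (c₀ : ℝ≥0∞) * ENNReal.ofReal (L ^ (1 - ρ)) := by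
        rw [haρ, ENNReal.ofReal_mul (Real.rpow_nonneg hS0.le _), ENNReal.ofReal_mul (Real.rpow_nonneg hσ0.le _)]
        ring

end PowerClockRigidity

end Summit.NavierStokesRegularity.NavierStokesRegularity.Theorems.PowerGaugeEulerLiouville

end
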